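import Summits.Ventures.PercRepro.RLSRuleOneLineCount

/-!
# PercRepro — the `5`-point plane «two `3`-point lines through a point»: traces and shares (night-3, gen 3)

Geometry of `G = ℓ ∪ ℓ′` (`TwoLines`: `|G| = 5`, simple, every `3`-subset other than `ℓ`, `ℓ′` independent), the last
of the six small trace types `𝒯₀` with a line (plane #6 of the lane's catalogue):

* `exists_indep_triple_of_four` (four `3`-subsets, at most two lines), `not_hasLongLine_of_twoLines`,
  `inter_eq_line_of_twoLines` (a plane `G' ≠ G` meeting `G` in `≥ 3` points meets it in `ℓ` or in `ℓ′`),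
  `rho3_of_twoLines` (`ρ₃(B′) = C(b, 3) − [ℓ ⊆ B′] − [ℓ′ ⊆ B′]`), `card_inter_le_one_of_twoLines`, `union_eq_of_twoLines`;
* `card_trace_le_five_of_twoLines`, `mstar_union_eq_zero_of_twoLines`, `wPlus_ge_of_twoLines`: in a witness good
  for the lines contained in `B′` (no coplanar triple of those lines inside `X`), every trace is in `𝒯₀` and `G`
  receives `ρ₃(B′)/C(b + x, 3)`.
The accounting and the per-flat inequality are in `RLSRuleTwoLines.lean`.  Imports `RLSRuleOneLineCount`.
Axioms: standard.
-/

open scoped Matroid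

namespace PercRepro

namespace NightThree

open Finset ThmH PerFlat

variable {α : Type*} [DecidableEq α] {M : Matroid α} [M.Finite]


/-- The `5`-point plane with two `3`-point lines: `G = ℓ ∪ ℓ′`, simple, every other `3`-subset independent. -/
def TwoLines (M : Matroid α) (G ℓ ℓ' : Finset α) : Prop :=
  ℓ ⊆ G ∧ ℓ' ⊆ G ∧ ℓ.card = 3 ∧ ℓ'.card = 3 ∧ M.eRk (ℓ : Set α) = 2 ∧ M.eRk (ℓ' : Set α) = 2 ∧ ℓ ≠ ℓ' ∧
    G.card = 5 ∧ SimpleOn M G ∧ ∀ T ∈ G.powersetCard 3, T ≠ ℓ → T ≠ ℓ' → M.Indep (T : Set α)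

omit [M.Finite] in
/-- Every `4`-subset of a `TwoLines` plane contains an independent triple (four `3`-subsets, at most two lines). -/
theorem exists_indep_triple_of_four {G ℓ ℓ' L : Finset α} (h : TwoLines M G ℓ ℓ') (hL : L ⊆ G) (hLc : L.card = 4) :
    ∃ T ⊆ L, T.card = 3 ∧ M.Indep (T : Set α) := by
  obtain ⟨hℓG, hℓ'G, hℓc, hℓ'c, hℓr, hℓ'r, hne, hGc, hsimple, hind⟩ := h
  by_contra hcon
  push Not at hcon
  have hall : ∀ x ∈ L, L.erase x = ℓ ∨ L.erase x = ℓ' := by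
    intro x hx
    have hc : (L.erase x).card = 3 := by rw [Finset.card_erase_of_mem hx, hLc]
    by_contra hnot
    push Not at hnot
    exact hcon (L.erase x) (Finset.erase_subset _ _) hc
      (hind _ (Finset.mem_powersetCard.2 ⟨(Finset.erase_subset _ _).trans hL, hc⟩) hnot.1 hnot.2)
  obtain ⟨x, hx⟩ := Finset.card_pos.1 (show 0 < L.card by omega)
  obtain ⟨y, hy, hyx⟩ : ∃ y ∈ L, y ≠ x := by
    by_contra hc; push Not at hc
    have := Finset.card_le_card (show L ⊆ {x} from fun z hz => Finset.mem_singleton.2 (hc z hz))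
    rw [Finset.card_singleton] at this; omega
  obtain ⟨z, hz, hzx, hzy⟩ : ∃ z ∈ L, z ≠ x ∧ z ≠ y := by
    by_contra hc; push Not at hc
    have hsub : L ⊆ {x, y} := fun w hw => by
      by_cases hwx : w = x
      · rw [hwx]; exact Finset.mem_insert_self _ _
      · rw [Finset.mem_insert, Finset.mem_singleton]; exact Or.inr (hc w hw hwx)
    have := Finset.card_le_card hsub
    have := Finset.card_le_two (a := x) (b := y)
    omega
  have hdist : ∀ a ∈ L, ∀ b ∈ L, a ≠ b → L.erase a ≠ L.erase b := by
    intro a ha b hb hab heq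
    have : b ∈ L.erase a := Finset.mem_erase.2 ⟨fun h => hab h.symm, hb⟩
    rw [heq] at this
    exact (Finset.mem_erase.1 this).1 rfl
  rcases hall x hx with h1 | h1 <;> rcases hall y hy with h2 | h2 <;> rcases hall z hz with h3 | h3 <;>
    first
    | exact hdist x hx y hy hyx.symm (h1.trans h2.symm)
    | exact hdist x hx z hz hzx.symm (h1.trans h3.symm)
    | exact hdist y hy z hz hzy.symm (h2.trans h3.symm)

omit [M.Finite] in
/-- No `4`-point subset of a `TwoLines` plane has rank `≤ 2`. -/
theorem not_hasLongLine_of_twoLines {G ℓ ℓ' B : Finset α} (h : TwoLines M G ℓ ℓ') (hB : B ⊆ G) :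
    ¬ HasLongLine M B := by
  rintro ⟨L, hL, hr⟩
  rw [Finset.mem_powersetCard] at hL
  obtain ⟨T, hTL, hTc, hTind⟩ := exists_indep_triple_of_four h (hL.1.trans hB) hL.2
  have h3 := eRk_eq_three_of_indep_card hTind hTc
  have := (M.eRk_mono (Finset.coe_subset.2 hTL)).trans hr
  rw [h3] at this
  exact absurd this (by norm_num)

/-- A plane `G' ≠ G` meeting the `TwoLines` plane `G` in at least `3` points meets it in `ℓ` or in `ℓ′`. -/
theorem inter_eq_line_of_twoLines {G ℓ ℓ' G' : Finset α} (hG : G ∈ flatsQ M 3) (h : TwoLines M G ℓ ℓ')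
    (hG' : G' ∈ flatsQ M 3) (hne : G' ≠ G) (h3 : 3 ≤ (G' ∩ G).card) : G' ∩ G = ℓ ∨ G' ∩ G = ℓ' := by
  have hindep : ∀ T ⊆ G' ∩ G, T.card = 3 → M.Indep (T : Set α) → False := by
    intro T hT hTc hTind
    have hT3 := eRk_eq_three_of_indep_card hTind hTc
    rw [flatsQ_three] at hG hG'
    exact hne (planes_eq_of_subset hG' hG (hT.trans Finset.inter_subset_left) (hT.trans Finset.inter_subset_right) hT3)
  have hc : (G' ∩ G).card = 3 := by
    by_contra hne3
    obtain ⟨L, hL, hLc⟩ := Finset.exists_subset_card_eq (show 4 ≤ (G' ∩ G).card by omega)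
    obtain ⟨T, hTL, hTc, hTind⟩ := exists_indep_triple_of_four h (hL.trans Finset.inter_subset_right) hLc
    exact hindep T (hTL.trans hL) hTc hTind
  obtain ⟨hℓG, hℓ'G, hℓc, hℓ'c, hℓr, hℓ'r, hneℓ, hGc, hsimple, hind⟩ := h
  by_contra hnot
  push Not at hnot
  exact hindep (G' ∩ G) le_rfl hc
    (hind _ (Finset.mem_powersetCard.2 ⟨Finset.inter_subset_right, hc⟩) hnot.1 hnot.2)

omit [M.Finite] in
/-- `ρ₃(B′) = C(|B′|, 3) − [ℓ ⊆ B′] − [ℓ′ ⊆ B′]` on a `TwoLines` plane. -/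
theorem rho3_of_twoLines {G ℓ ℓ' B : Finset α} (h : TwoLines M G ℓ ℓ') (hB : B ⊆ G) :
    rho3 M B = B.card.choose 3 - (if ℓ ⊆ B then 1 else 0) - (if ℓ' ⊆ B then 1 else 0) := by
  classical
  obtain ⟨hℓG, hℓ'G, hℓc, hℓ'c, hℓr, hℓ'r, hne, hGc, hsimple, hind⟩ := h
  unfold rho3
  have hfilter : (B.powersetCard 3).filter (fun (T : Finset α) => M.Indep (T : Set α)) =
      ((B.powersetCard 3).erase ℓ).erase ℓ' := by
    ext T
    rw [Finset.mem_filter, Finset.mem_erase, Finset.mem_erase, Finset.mem_powersetCard]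
    constructor
    · rintro ⟨⟨hTB, hTc⟩, hTi⟩
      refine ⟨?_, ?_, hTB, hTc⟩
      · rintro rfl
        have := eRk_eq_three_of_indep_card hTi hTc
        rw [hℓ'r] at this
        exact absurd this (by norm_num)
      · rintro rfl
        have := eRk_eq_three_of_indep_card hTi hTc
        rw [hℓr] at this
        exact absurd this (by norm_num)
    · rintro ⟨hne', hneℓ, hTB, hTc⟩
      exact ⟨⟨hTB, hTc⟩, hind T (Finset.mem_powersetCard.2 ⟨hTB.trans hB, hTc⟩) hneℓ hne'⟩
  rw [hfilter, Finset.card_erase_eq_ite, Finset.card_erase_eq_ite, Finset.card_powersetCard]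
  have hmℓ : ℓ ∈ B.powersetCard 3 ↔ ℓ ⊆ B := by
    rw [Finset.mem_powersetCard]; exact ⟨fun h => h.1, fun h => ⟨h, hℓc⟩⟩
  have hmℓ' : ℓ' ∈ (B.powersetCard 3).erase ℓ ↔ ℓ' ⊆ B := by
    rw [Finset.mem_erase, Finset.mem_powersetCard]; exact ⟨fun h => h.2.1, fun h => ⟨hne.symm, h, hℓ'c⟩⟩
  simp only [hmℓ, hmℓ']
  split_ifs <;> omega

/-- The traces of `B′ ∪ X` other than `B′` have at most `5` points when `X` is good for every line inside `B′`. -/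
theorem card_trace_le_five_of_twoLines {G ℓ ℓ' K B X G' : Finset α} (hG : G ∈ flatsQ M 3)
    (h : TwoLines M G ℓ ℓ') (hB : B ⊆ G) (hX : M.Indep (X : Set α)) (hXK : X ⊆ K)
    (hgood : (ℓ ⊆ B → GoodWitness M ℓ K X) ∧ (ℓ' ⊆ B → GoodWitness M ℓ' K X))
    (hG' : G' ∈ flatsQ M 3) (hne : G' ≠ G) : (G' ∩ (B ∪ X)).card ≤ 5 := by
  have hle := card_inter_union_le (B := B) (X := X) hG' hX
  have hsplit : (G' ∩ (B ∪ X)).card ≤ (G' ∩ B).card + (G' ∩ X).card := by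
    rw [Finset.inter_union_distrib_left]; exact Finset.card_union_le _ _
  -- the common machine for a line `m` of `G`
  have key : ∀ m : Finset α, m.card = 3 → G' ∩ G = m → (m ⊆ B → GoodWitness M m K X) →
      (G' ∩ (B ∪ X)).card ≤ 5 := by
    intro m hmc hGGm hgm
    have hsub : G' ∩ B ⊆ m := by
      intro x hx
      rw [Finset.mem_inter] at hx
      rw [← hGGm, Finset.mem_inter]
      exact ⟨hx.1, hB hx.2⟩
    by_cases hmB : m ⊆ B
    · have h3 : (G' ∩ B).card ≤ 3 := (Finset.card_le_card hsub).trans (by rw [hmc])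
      have hGX : (G' ∩ X).card ≤ 2 := by
        by_contra hc
        push Not at hc
        have hind : M.Indep ((G' ∩ X : Finset α) : Set α) :=
          hX.subset (Finset.coe_subset.2 Finset.inter_subset_right)
        have hle3 : M.eRk ((G' ∩ X : Finset α) : Set α) ≤ 3 := by
          rw [← eRk_eq_three_of_mem_flatsQ' hG']
          exact M.eRk_mono (Finset.coe_subset.2 Finset.inter_subset_left)
        rw [eRk_eq_card_of_indep hind] at hle3
        have hc3 : (G' ∩ X).card = 3 := le_antisymm (by exact_mod_cast hle3) hc
        apply hgm hmB (G' ∩ X)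
        · unfold coplanarTriples
          rw [Finset.mem_filter, Finset.mem_powersetCard]
          refine ⟨⟨Finset.inter_subset_right.trans hXK, hc3⟩, ?_⟩
          rw [← eRk_eq_three_of_mem_flatsQ' hG']
          apply M.eRk_mono
          rw [Finset.coe_union]
          apply Set.union_subset
          · rw [← hGGm, Finset.coe_inter]; exact Set.inter_subset_left
          · rw [Finset.coe_inter]; exact Set.inter_subset_left
        · exact Finset.inter_subset_right
      omega
    · have h2 : (G' ∩ B).card ≤ 2 := by
        by_contra hc
        push Not at hc
        have : G' ∩ B = m := Finset.eq_of_subset_of_card_le hsub (by omega)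
        apply hmB
        rw [← this]
        exact Finset.inter_subset_right
      omega
  rcases lt_or_ge (G' ∩ G).card 3 with hlt | hge
  · have : (G' ∩ B).card ≤ (G' ∩ G).card := Finset.card_le_card (Finset.inter_subset_inter_left hB)
    omega
  · rcases inter_eq_line_of_twoLines hG h hG' hne hge with hℓ | hℓ'
    · exact key ℓ h.2.2.1 hℓ hgood.1
    · exact key ℓ' h.2.2.2.1 hℓ' hgood.2

/-- Every trace of `B′ ∪ X` is in `𝒯₀` when `X` is good for the lines inside `B′` (`|B′| ≤ 5` automatically). -/
theorem mstar_union_eq_zero_of_twoLines {G ℓ ℓ' K B X : Finset α} (hG : G ∈ flatsQ M 3)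
    (h : TwoLines M G ℓ ℓ') (hB : B ⊆ G) (hX : M.Indep (X : Set α)) (hXG : Disjoint X G) (hXK : X ⊆ K)
    (hgood : (ℓ ⊆ B → GoodWitness M ℓ K X) ∧ (ℓ' ⊆ B → GoodWitness M ℓ' K X)) :
    mstar M (B ∪ X) = 0 := by
  have hsimple : SimpleOn M G := h.2.2.2.2.2.2.2.2.1
  have hBc : B.card ≤ 5 := by rw [← h.2.2.2.2.2.2.2.1]; exact Finset.card_le_card hB
  rw [mstar_eq_zero_iff]
  intro G' hG' hn
  obtain ⟨_, hbig⟩ := hn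
  rcases hbig with h6 | hline
  · by_cases hGG : G' = G
    · rw [hGG, inter_union_eq_of_disjoint hB hXG] at h6
      exact absurd (h6.trans hBc) (by norm_num)
    · have := card_trace_le_five_of_twoLines hG h hB hX hXK hgood hG' hGG
      omega
  · exact not_hasLongLine_of_twoLines h hB
      (hasLongLine_of_union hG hsimple hB hX hXG Finset.inter_subset_right hline)

/-- The share of `G` in a good witness: `ρ₃(B′) / C(b + x, 3)`. -/
theorem wPlus_ge_of_twoLines {G ℓ ℓ' K B X : Finset α} (hG : G ∈ flatsQ M 3) (h : TwoLines M G ℓ ℓ')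
    (hB : B ⊆ G) (hX : M.Indep (X : Set α)) (hXG : Disjoint X G) (hXK : X ⊆ K)
    (hgood : (ℓ ⊆ B → GoodWitness M ℓ K X) ∧ (ℓ' ⊆ B → GoodWitness M ℓ' K X)) :
    ((B.card.choose 3 - (if ℓ ⊆ B then 1 else 0) - (if ℓ' ⊆ B then 1 else 0) : ℕ) : ℚ) /
        (((B.card + X.card).choose 3 : ℕ) : ℚ) ≤ wPlus M G (B ∪ X) := by
  have hS : B ∪ X ⊆ gr M := by
    apply Finset.union_subset (hB.trans (mem_flatsQ.1 hG).1)
    rw [← Finset.coe_subset, coe_gr]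
    exact hX.subset_ground
  have hw := wPlus_ge_of_mstar_zero hS (mstar_union_eq_zero_of_twoLines hG h hB hX hXG hXK hgood) G
  rw [inter_union_eq_of_disjoint hB hXG, rho3_of_twoLines h hB,
    Finset.card_union_of_disjoint (Finset.disjoint_of_subset_right hB hXG).symm] at hw
  exact hw

/-- The two lines of a `TwoLines` plane meet in at most one point (two common points would put `ℓ ∪ ℓ′`, a
`4`-set, inside a rank-`2` closure, against its independent triple). -/
theorem card_inter_le_one_of_twoLines {G ℓ ℓ' : Finset α} (hG : G ∈ flatsQ M 3) (h : TwoLines M G ℓ ℓ') :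
    (ℓ ∩ ℓ').card ≤ 1 := by
  obtain ⟨hℓG, hℓ'G, hℓc, hℓ'c, hℓr, hℓ'r, hne, hGc, hsimple, hind⟩ := h
  have h' : TwoLines M G ℓ ℓ' := ⟨hℓG, hℓ'G, hℓc, hℓ'c, hℓr, hℓ'r, hne, hGc, hsimple, hind⟩
  by_contra hc
  push Not at hc
  have hc2 : (ℓ ∩ ℓ').card ≤ 2 := by
    by_contra hc2
    push Not at hc2
    have heq : ℓ ∩ ℓ' = ℓ := Finset.eq_of_subset_of_card_le Finset.inter_subset_left (by omega)
    have heq' : ℓ ∩ ℓ' = ℓ' := Finset.eq_of_subset_of_card_le Finset.inter_subset_right (by omega)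
    exact hne (heq.symm.trans heq')
  have h1 := Finset.card_union_add_card_inter ℓ ℓ'
  have hu4 : (ℓ ∪ ℓ').card = 4 := by omega
  obtain ⟨T, hTL, hTc, hTind⟩ := exists_indep_triple_of_four h' (Finset.union_subset hℓG hℓ'G) hu4
  obtain ⟨P, hPsub, hPc⟩ := Finset.exists_subset_card_eq hc
  have hPℓ : P ⊆ ℓ := hPsub.trans Finset.inter_subset_left
  have hPℓ' : P ⊆ ℓ' := hPsub.trans Finset.inter_subset_right
  obtain ⟨u, v, huv, rfl⟩ := Finset.card_eq_two.1 hPc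
  have hPr : M.eRk (({u, v} : Finset α) : Set α) = 2 := by
    rw [Finset.coe_pair]
    exact hsimple u (hℓG (hPℓ (by simp))) v (hℓG (hPℓ (by simp))) huv
  have hℓE : (ℓ : Set α) ⊆ M.E := by
    rw [← coe_gr M]; exact Finset.coe_subset.2 (hℓG.trans (mem_flatsQ.1 hG).1)
  have hℓ'E : (ℓ' : Set α) ⊆ M.E := by
    rw [← coe_gr M]; exact Finset.coe_subset.2 (hℓ'G.trans (mem_flatsQ.1 hG).1)
  have hcl : M.closure (({u, v} : Finset α) : Set α) = M.closure (ℓ : Set α) :=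
    closure_eq_of_subset_flat (M.isFlat_closure _)
      ((Finset.coe_subset.2 hPℓ).trans (M.subset_closure _ hℓE)) (Finset.finite_toSet _)
      (by rw [M.eRk_closure_eq, hPr, hℓr])
  have hcl' : M.closure (({u, v} : Finset α) : Set α) = M.closure (ℓ' : Set α) :=
    closure_eq_of_subset_flat (M.isFlat_closure _)
      ((Finset.coe_subset.2 hPℓ').trans (M.subset_closure _ hℓ'E)) (Finset.finite_toSet _)
      (by rw [M.eRk_closure_eq, hPr, hℓ'r])
  have hTsub : (T : Set α) ⊆ M.closure (ℓ : Set α) := by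
    intro x hx
    have hxU := hTL hx
    rcases Finset.mem_union.1 hxU with hxℓ | hxℓ'
    · exact M.subset_closure _ hℓE (Finset.mem_coe.2 hxℓ)
    · rw [← hcl, hcl']
      exact M.subset_closure _ hℓ'E (Finset.mem_coe.2 hxℓ')
  have := M.eRk_mono hTsub
  rw [M.eRk_closure_eq, hℓr, eRk_eq_three_of_indep_card hTind hTc] at this
  exact absurd this (by norm_num)

/-- `ℓ ∪ ℓ′ = G`: five points. -/
theorem union_eq_of_twoLines {G ℓ ℓ' : Finset α} (hG : G ∈ flatsQ M 3) (h : TwoLines M G ℓ ℓ') : ℓ ∪ ℓ' = G := by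
  have hmeet := card_inter_le_one_of_twoLines hG h
  obtain ⟨hℓG, hℓ'G, hℓc, hℓ'c, _, _, _, hGc, _, _⟩ := h
  have h1 := Finset.card_union_add_card_inter ℓ ℓ'
  exact Finset.eq_of_subset_of_card_le (Finset.union_subset hℓG hℓ'G) (by omega)

end NightThree

end PercRepro
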